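import Mathlib
import Summits.Ventures.PercRepro2.PMK5Deg3Kernel
import Summits.Ventures.PercRepro2.PMK5Deg3LitsOA2B
import Summits.Ventures.PercRepro2.PMK5Deg3CertsOA2B1
import Summits.Ventures.PercRepro2.PMK5Deg3CertsOA2B2
import Summits.Ventures.PercRepro2.PMK5Deg3CertsOA2B3
import Summits.Ventures.PercRepro2.PMK5Deg3CertsOA2B4
import Summits.Ventures.PercRepro2.Deg3Conn
import Summits.Ventures.PercRepro2.Deg3Typed

/-!
# THEOREM 28 ON THE TRIPLE `(o, a₂, b)`: ROW 2′TRI AND (HCOV) ON `K₅ + {a₃o, a₃a₂, a₃b}` FOR EVERY WEIGHT VECTOR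
(blind cell PercRepro2, mine-2 g27)

The sixteen slice certificates `cert_oa2b` and the certified literals `litOK_oa2b`, read through the slice
decomposition and the digit bridge by `Deg3Typed.HCov_deg3`.  Standard axioms only.
-/

namespace Summit.Ventures.PercRepro2

namespace Deg3

/-- **All sixteen slice certificates of the triple `(0, 2, 4)`.** -/
theorem cert_oa2b : Cert Loa2b := by
  intro j₁ j₂
  fin_cases j₁ <;> fin_cases j₂
  · exact certS_oa2b_00
  · exact certS_oa2b_01
  · exact certS_oa2b_02
  · exact certS_oa2b_03
  · exact certS_oa2b_10
  · exact certS_oa2b_11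
  · exact certS_oa2b_12
  · exact certS_oa2b_13
  · exact certS_oa2b_20
  · exact certS_oa2b_21
  · exact certS_oa2b_22
  · exact certS_oa2b_23
  · exact certS_oa2b_30
  · exact certS_oa2b_31
  · exact certS_oa2b_32
  · exact certS_oa2b_33

variable {R : Type*} [Field R] [LinearOrder R] [IsStrictOrderedRing R]

/-- **Row 2′TRI on `K₅ + {a₃o, a₃a₂, a₃b}`**: every weight-free typed count of `K₃` is nonnegative. -/
theorem typedBases_oa2b : CovForm.TypedBases (R := R) (ends13 0 2 4) 0 1 2 5 4 :=
  typedBases 0 2 4 litOK_oa2b cert_oa2b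

/-- **THEOREM 28 on the triple `(0, 2, 4)`: (HCOV) on `K₅ + {a₃o, a₃a₂, a₃b}` for every weight vector** (missing edges
at weight `0`). -/
theorem HCov_deg3_oa2b (p : Fin 13 → R) (hp : IsProbVec p) : CovForm.HCov p (ends13 0 2 4) 0 1 2 5 4 :=
  HCov_deg3 0 2 4 litOK_oa2b cert_oa2b p hp

end Deg3

end Summit.Ventures.PercRepro2
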